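import Summits.HodgeConjecture.CorCM.CyclotomicTwoPowerPResidueDescent
import Summits.HodgeConjecture.CorCM.CyclotomicTwoPowerPResidueField
import Summits.HodgeConjecture.CorCM.CyclotomicTwoPowerPNormObstruction
import Mathlib.FieldTheory.IntermediateField.Adjoin.Basic
import Mathlib.RingTheory.Localization.Integral
import HarnessLib

/-!
# A primitive `2^{a+1}`-th root of unity is not a norm from `ℚ(ζ_{2^{a+1}p})` to the fixed field of the automorphism
# fixing `μ_{2^{a+1}}` and inverting `μ_p`, whenever `2^{a+1} ∣ p^f − 1` and `2^{a+2} ∤ p^f − 1` — inside `ℂ`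

COR-CM (cell `pub-hodgecm2`), binder seat b04 (gen 26), count-neutral claim CYCLIC-SEMIDIRECT-RESIDUE, part IIIc♯ — the
residue-field form of `CorCM/CyclotomicTwoPowerPNormObstruction` (the case `f = 1`): the arithmetic hypothesis `hN` of
`CorCM/GaloisCyclicSemidirectTwoPowerTwoSheet` / `…Nondegenerate` discharged for `M = ℚ(ζ_{2^{a+1}p}) ⊆ ℂ` and the embedding
`ρ : ζ ↦ ζ^e` (`e ≡ 1 (mod 2^{a+1})`, `e ≡ −1 (mod p)`), from the residue-field descent of part IIIb♯
(`CorCM/CyclotomicTwoPowerPResidueDescent`) at `k = 𝔽_{p^f}`.  Mathlib only.  KERNEL ONLY: theorems; no definition, no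
named fact, no `sorry`.

THEOREM (`exists_subfield_rho_of_pow_sub_one`).  For every odd prime `p` and every `f` with `2^{a+1} ∣ p^f − 1` and
`2^{a+2} ∤ p^f − 1` there are a subfield `M ⊆ ℂ` containing `μ_{2^{a+1}p}` and a ring map `ρ : M → ℂ` with `ρ(z) = z` for
`z^{2^{a+1}} = 1`, `ρ(z) = z⁻¹` for `z^p = 1`, such that `z₁ ρ(z₁) = ω · z₂ ρ(z₂)`, `ω^{2^a} = −1 ⟹ z₁ = z₂ = 0`.
(The local obstruction at the primes of `ℚ(ζ_{2^{a+1}}, ζ_p + ζ_p⁻¹)` above `p`: the residue field is `𝔽_{p^f}`,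
`f = ord_{2^{a+1}}(p)`, and a primitive `2^{a+1}`-th root of unity is a square there iff `2^{a+2} ∣ p^f − 1`.  The condition
does not depend on the choice of `f`: if it holds for one `f` with `2^{a+1} ∣ p^f − 1` it holds for the order.)

* **`exists_subfield_rho_of_pow_sub_one`** (inputs: `CorCM/CyclotomicTwoPowerPResidueField` — the CRT exponent `exists_exp`
  and the residue field `exists_residue` — and the descent `descentK` of `CorCM/CyclotomicTwoPowerPResidueDescent`).

## References

* [FeinGordonSmith1971] B. Fein, B. Gordon, J. H. Smith, J. Number Theory 3 (1971), 310–315.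
* [Washington1997] L. C. Washington, *Introduction to Cyclotomic Fields*, Thm. 2.13.
-/

noncomputable section

open Polynomial IntermediateField

namespace Summit.HodgeConjecture.CorCM.CyclotomicTwoPowerP.Residue

variable {p a : ℕ}

/-! ## The subfield `ℚ(ζ_{2^{a+1}p})` and the embedding `ρ : ζ ↦ ζ^e` -/

/-- **THE NORM OBSTRUCTION (residue-field form).**  `p` an odd prime, `2^{a+1} ∣ p^f − 1`, `2^{a+2} ∤ p^f − 1`.  With
`M = ℚ(ζ_{2^{a+1}p}) ⊆ ℂ` and `ρ : M → ℂ`, `ζ ↦ ζ^e` (`e ≡ 1 (mod 2^{a+1})`, `e ≡ −1 (mod p)`): `M ⊇ μ_{2^{a+1}p}`, `ρ` fixes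
`μ_{2^{a+1}}` and inverts `μ_p`, and `z₁ ρ(z₁) = ω z₂ ρ(z₂)` with `ω^{2^a} = −1` forces `z₁ = z₂ = 0` — a primitive
`2^{a+1}`-th root of unity is not a norm from `ℚ(ζ_{2^{a+1}p})` to the fixed field of `ρ`.
[cite: FeinGordonSmith1971, pp. 310–315] -/
theorem exists_subfield_rho_of_pow_sub_one (hp : p.Prime) (hp2 : p ≠ 2) {f : ℕ} (hf1 : 2 ^ (a + 1) ∣ p ^ f - 1)
    (hf2 : ¬ 2 ^ (a + 2) ∣ p ^ f - 1) :
    ∃ (M : Subfield ℂ) (ρ : M →+* ℂ), (∀ z : ℂ, z ^ (2 ^ (a + 1) * p) = 1 → z ∈ M) ∧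
      (∀ z : M, (z : ℂ) ^ 2 ^ (a + 1) = 1 → ρ z = z) ∧ (∀ z : M, (z : ℂ) ^ p = 1 → ρ z = (z : ℂ)⁻¹) ∧
      (∀ (z₁ z₂ : M) (ω : ℂ), ω ^ 2 ^ a = -1 → (z₁ : ℂ) * ρ z₁ = ω * ((z₂ : ℂ) * ρ z₂) →
        (z₁ : ℂ) = 0 ∧ (z₂ : ℂ) = 0) := by
  classical
  haveI : Fact p.Prime := ⟨hp⟩
  obtain ⟨e, he, hpe⟩ := exists_exp (a := a) hp hp2
  obtain ⟨s, hs, hk⟩ := exists_residue (a := a) hp2 hf1 hf2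
  have hecop := coprime_exp hp he hpe
  -- `e = 2^{a+1} q + 1` and `e + 1 = p r`
  have hdm := Nat.div_add_mod e (2 ^ (a + 1))
  rw [he] at hdm
  set q := e / 2 ^ (a + 1) with hq_def
  obtain ⟨r, hr⟩ := Nat.dvd_of_mod_eq_zero hpe
  have hp0 : 0 < p := hp.pos
  haveI : NeZero (2 ^ (a + 1) * p) := ⟨by positivity⟩
  have hζ := Complex.isPrimitiveRoot_exp (2 ^ (a + 1) * p) (by positivity)
  set ζ := Complex.exp (2 * Real.pi * Complex.I / (2 ^ (a + 1) * p : ℕ)) with hζ_def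
  have hζint : IsIntegral ℚ ζ := (hζ.isIntegral (by positivity)).tower_top
  -- the power basis of `ℚ⟮ζ⟯` and the embedding `ρ₀ : ζ ↦ ζ^e`
  set pb := IntermediateField.adjoin.powerBasis hζint with hpb_def
  have hgen : pb.gen = AdjoinSimple.gen ℚ ζ := IntermediateField.adjoin.powerBasis_gen hζint
  have hmin : minpoly ℚ pb.gen = cyclotomic (2 ^ (a + 1) * p) ℚ := by
    rw [hgen, cyclotomic_eq_minpoly_rat hζ (by positivity)]
    exact IntermediateField.minpoly_gen (F := ℚ) ζ
  have hρ₀ : aeval (ζ ^ e) (minpoly ℚ pb.gen) = 0 := by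
    rw [hmin, aeval_def, eval₂_eq_eval_map, map_cyclotomic, ← IsRoot.def, isRoot_cyclotomic_iff]
    exact hζ.pow_of_coprime _ hecop
  set ρ₀ : ℚ⟮ζ⟯ →ₐ[ℚ] ℂ := pb.lift (ζ ^ e) hρ₀ with hρ₀_def
  have hρ₀gen : ρ₀ (AdjoinSimple.gen ℚ ζ) = ζ ^ e := by
    have h := pb.lift_gen (ζ ^ e) hρ₀
    rw [hgen] at h
    exact h
  -- powers of `ζ` as elements of `ℚ⟮ζ⟯`
  have hmem : ∀ m : ℕ, ζ ^ m ∈ ℚ⟮ζ⟯ := fun m => pow_mem (mem_adjoin_simple_self ℚ ζ) m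
  have hρ₀pow : ∀ m : ℕ, ρ₀ ⟨ζ ^ m, hmem m⟩ = ζ ^ (e * m) := fun m => by
    have : (⟨ζ ^ m, hmem m⟩ : ℚ⟮ζ⟯) = AdjoinSimple.gen ℚ ζ ^ m := Subtype.ext (by simp [AdjoinSimple.coe_gen])
    rw [this, map_pow, hρ₀gen, ← pow_mul]
  refine ⟨ℚ⟮ζ⟯.toSubfield, ρ₀.toRingHom, fun z hz => ?_, fun z hz => ?_, fun z hz => ?_, fun z₁ z₂ ω hω hrel => ?_⟩
  · -- `μ_{2^{a+1}p} ⊆ M`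
    obtain ⟨m, -, rfl⟩ := hζ.eq_pow_of_pow_eq_one hz
    exact hmem m
  · -- `ρ` fixes the `2^{a+1}`-th roots of unity `ζ^{m}`, `p ∣ m`
    have hzn : (z : ℂ) ^ (2 ^ (a + 1) * p) = 1 := by rw [pow_mul, hz, one_pow]
    obtain ⟨m, -, hm⟩ := hζ.eq_pow_of_pow_eq_one hzn
    have hzm : z = ⟨ζ ^ m, hmem m⟩ := Subtype.ext hm.symm
    have hpm : 2 ^ (a + 1) * p ∣ 2 ^ (a + 1) * m := hζ.dvd_of_pow_eq_one _ (by rw [mul_comm, pow_mul, hm, hz])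
    obtain ⟨m', rfl⟩ : p ∣ m := Nat.dvd_of_mul_dvd_mul_left (by positivity) hpm
    rw [hzm, AlgHom.toRingHom_eq_coe, RingHom.coe_coe, hρ₀pow]
    change ζ ^ (e * (p * m')) = ζ ^ (p * m')
    have harith : e * (p * m') = p * m' + (2 ^ (a + 1) * p) * (q * m') := by
      rw [← hdm]; ring
    rw [harith, pow_add, show ζ ^ (2 ^ (a + 1) * p * (q * m')) = 1 by
      rw [pow_mul, hζ.pow_eq_one, one_pow], mul_one]
  · -- `ρ` inverts the `p`-th roots of unity `ζ^{m}`, `2^{a+1} ∣ m`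
    have hzn : (z : ℂ) ^ (2 ^ (a + 1) * p) = 1 := by rw [mul_comm, pow_mul, hz, one_pow]
    obtain ⟨m, -, hm⟩ := hζ.eq_pow_of_pow_eq_one hzn
    have hzm : z = ⟨ζ ^ m, hmem m⟩ := Subtype.ext hm.symm
    have hpm : 2 ^ (a + 1) * p ∣ p * m := hζ.dvd_of_pow_eq_one _ (by rw [mul_comm, pow_mul, hm, hz])
    obtain ⟨m', rfl⟩ : 2 ^ (a + 1) ∣ m :=
      Nat.dvd_of_mul_dvd_mul_left hp0 (by rw [mul_comm (2 ^ (a + 1)) p] at hpm; exact hpm)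
    rw [hzm, AlgHom.toRingHom_eq_coe, RingHom.coe_coe, hρ₀pow]
    change ζ ^ (e * (2 ^ (a + 1) * m')) = (ζ ^ (2 ^ (a + 1) * m'))⁻¹
    refine eq_inv_of_mul_eq_one_left ?_
    have harith : e * (2 ^ (a + 1) * m') + 2 ^ (a + 1) * m' = (2 ^ (a + 1) * p) * (r * m') := by
      rw [← add_one_mul, hr]; ring
    rw [← pow_add, harith, pow_mul, hζ.pow_eq_one, one_pow]
  · -- the norm obstruction
    replace hrel : (z₁ : ℂ) * ρ₀ z₁ = ω * ((z₂ : ℂ) * ρ₀ z₂) := hrel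
    by_cases hz₂ : (z₂ : ℂ) = 0
    · refine ⟨?_, hz₂⟩
      rw [hz₂, zero_mul, mul_zero] at hrel
      rcases mul_eq_zero.1 hrel with h | h
      · exact h
      · rw [map_eq_zero] at h
        rw [h]; rfl
    exfalso
    -- `w = z₁ / z₂` has `w ρ(w) = ω`
    set w : ℚ⟮ζ⟯ := z₁ / z₂ with hw_def
    have hz₂' : z₂ ≠ 0 := fun h => hz₂ (by rw [h]; rfl)
    have hρz₂ : ρ₀ z₂ ≠ 0 := by rw [Ne, map_eq_zero]; exact hz₂'
    have hwrel : (w : ℂ) * ρ₀ w = ω := by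
      rw [hw_def, map_div₀]
      push_cast
      rw [div_mul_div_comm, div_eq_iff (mul_ne_zero hz₂ hρz₂), hrel]
    -- `ω = ζ^{pj}`, `j` odd
    obtain ⟨j, hj, hωj⟩ := eq_pow_odd_of_pow_eq_neg_one hp hp2 hω
    -- `w = f(ζ)`, `f ∈ ℚ[X]`; clear denominators: `F = b f ∈ ℤ[X]`
    have hwmem : (w : ℂ) ∈ Algebra.adjoin ℚ {ζ} := by
      rw [← adjoin_simple_toSubalgebra_of_isAlgebraic hζint.isAlgebraic]
      exact w.2
    rw [Algebra.adjoin_singleton_eq_range_aeval] at hwmem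
    obtain ⟨f₁, hf⟩ := hwmem
    replace hf : aeval ζ f₁ = (w : ℂ) := hf
    obtain ⟨b, hb, hF⟩ := IsLocalization.integerNormalization_spec (nonZeroDivisors ℤ) f₁
    set F := IsLocalization.integerNormalization (nonZeroDivisors ℤ) f₁ with hF_def
    have hb0 : b ≠ 0 := nonZeroDivisors.ne_zero hb
    have hFζ : ∀ x : ℂ, aeval x F = (b : ℂ) * aeval x f₁ := fun x => by
      rw [← aeval_map_algebraMap ℚ x F, hF, map_zsmul, zsmul_eq_mul]
    -- `ρ₀ (f(ζ)) = f(ζ^e)`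
    have hwgen : w = aeval (AdjoinSimple.gen ℚ ζ) f₁ := by
      apply Subtype.ext
      have h := IntermediateField.aeval_coe (S := ℚ⟮ζ⟯) (R := ℚ) (AdjoinSimple.gen ℚ ζ) f₁
      rw [AdjoinSimple.coe_gen] at h
      exact hf.symm.trans h
    have hρw : ρ₀ w = aeval (ζ ^ e) f₁ := by
      rw [hwgen]
      have h := pb.lift_aeval (ζ ^ e) hρ₀ f₁
      simp only [hgen] at h
      exact h
    -- the relation in `Λ = ℤ[X]/(Φ_{2^{a+1}p})`
    set n : ℕ := b.natAbs with hn_def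
    have hn : 0 < n := Int.natAbs_pos.2 hb0
    have hev := lift_exp_injective (a := a) hp0
    have hrelΛ : AdjoinRoot.mk (cyclotomic (2 ^ (a + 1) * p) ℤ) F *
        AdjoinRoot.lift (algebraMap ℤ _) (AdjoinRoot.root (cyclotomic (2 ^ (a + 1) * p) ℤ) ^ e)
          (eval₂_root_pow_cyclotomic hp0 hecop)
            (AdjoinRoot.mk (cyclotomic (2 ^ (a + 1) * p) ℤ) F) =
        (n : AdjoinRoot (cyclotomic (2 ^ (a + 1) * p) ℤ)) ^ 2 *
          (AdjoinRoot.root (cyclotomic (2 ^ (a + 1) * p) ℤ) ^ (p * j) * 1) := by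
      apply hev
      have h1 : AdjoinRoot.lift (algebraMap ℤ ℂ) _ (eval₂_cyclotomic_exp hp0)
          (AdjoinRoot.mk (cyclotomic (2 ^ (a + 1) * p) ℤ) F) = aeval ζ F := lift_exp_mk hp0 F
      have h2 : AdjoinRoot.lift (algebraMap ℤ ℂ) _ (eval₂_cyclotomic_exp hp0)
          (AdjoinRoot.lift (algebraMap ℤ _) (AdjoinRoot.root (cyclotomic (2 ^ (a + 1) * p) ℤ) ^ e)
            (eval₂_root_pow_cyclotomic hp0 hecop)
              (AdjoinRoot.mk (cyclotomic (2 ^ (a + 1) * p) ℤ) F)) = aeval (ζ ^ e) F := by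
        rw [AdjoinRoot.lift_mk, hom_eval₂, map_pow, AdjoinRoot.lift_root]
        have hc : (AdjoinRoot.lift (algebraMap ℤ ℂ) ζ (eval₂_cyclotomic_exp hp0)).comp
            (algebraMap ℤ (AdjoinRoot (cyclotomic (2 ^ (a + 1) * p) ℤ))) = algebraMap ℤ ℂ := Subsingleton.elim _ _
        rw [hc, ← aeval_def]
      have hn2 : ((n : ℕ) : ℂ) ^ 2 = (b : ℂ) ^ 2 := by
        have e2 := congrArg (Int.cast : ℤ → ℂ) (Int.natAbs_pow_two b)
        rwa [Int.cast_pow, Int.cast_pow, Int.cast_natCast] at e2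
      rw [map_mul, h1, h2, map_mul, map_mul, map_pow, map_natCast, map_one, mul_one, map_pow, AdjoinRoot.lift_root,
        hn2, ← hωj, hFζ, hFζ, hf, ← hρw, ← hwrel]
      ring
    exact descentK hp hp2 he hpe hs hk hj n hn _ 1 1 one_ne_zero (by rw [map_one, one_pow]) hrelΛ

end Summit.HodgeConjecture.CorCM.CyclotomicTwoPowerP.Residue

end
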